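import Literature.Probability.Percolation.KozmaNitzanClusterProperty
import HarnessLib

/-!
# `NoHeavyLowerTail` (stmt-CriticalPhenomena-4575) — the avoiding-witness bound (IG₁) for ONE-LAYER observers
# (Kozma–Nitzan's Theorem-8 class), every level

Companion of `Theorems/PercNearOneGluingNoHeavyLowerTailAvoidingWitness.lean` (prim-hp-4 gen 3).  The avoiding-witness
bound in its `max` form,

  (IG₁)  `μ(1 ≤ N ≤ j, o ↮ a₁) ≤ max_{b ∈ A ∖ a₁} μ(b ↮ a₁, M_b ≤ j)`,

is Kozma–Nitzan's Conjecture 4 for the monotone EVENT cluster property `P(K) = (a₁ ∈ K) ∨ (j < |K ∩ A|)`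
(complement of "`K` avoids `a₁` and holds at most `j` relays").  Hence it holds on the class of KN's Theorem 8:
observers `o` all of whose positive-weight edges go to relays ("one-layer" / "`o` isolated in `G ∖ A`"), for every
`|A| ≥ 2`, every `a₁ ∈ A` and every level `j` — in the stronger ATTACHED form with `{o ↔ A}` kept on the right:
`μ(o ↔ A, o ↮ a₁, N ≤ j) ≤ μ(o ↔ A, b ↮ a₁, M_b ≤ j)` for some `b ∈ A ∖ a₁` (`avoidingMax_oneLayer_attached`),
and in the shape of the hypothesis of `Theorems.noHeavyLowerTail_of_avoidingMax` (`avoidingMax_oneLayer`).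
Proof: `KozmaNitzan2024_thm8_event` (tree, proved) with that `P`; if the witness is `a₁` itself the left side
vanishes.  No sorries, standard axioms.
-/

noncomputable section

namespace Summit.CriticalPhenomena.PercolationContinuityZ3.Theorems

open MeasureTheory Set Literature.Probability.LatticeModels Literature.Probability.Percolation
open scoped Classical BigOperators

variable {n : ℕ}

namespace AvoidingWitnessOneLayer

/-- The KN cluster property used: `P(K) = a₁ ∈ K ∨ j < |K ∩ A|` is monotone. [this file] -/
theorem prop_mono (A : Finset (Fin n)) (a₁ : Fin n) (j : ℕ) :
    ∀ S T : Set (Fin n), S ⊆ T →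
      (a₁ ∈ S ∨ j < (A.filter fun z => z ∈ S).card) → (a₁ ∈ T ∨ j < (A.filter fun z => z ∈ T).card) := by
  intro S T hST h
  rcases h with h | h
  · exact Or.inl (hST h)
  · right
    refine lt_of_lt_of_le h (Finset.card_le_card ?_)
    intro z hz
    rw [Finset.mem_filter] at hz ⊢
    exact ⟨hz.1, hST hz.2⟩

/-- The relay count of the cluster of `x` is the number of relays joined to `x`. [folklore] -/
theorem filter_openCluster (A : Finset (Fin n)) (ω : BondConfig (Fin n)) (x : Fin n) :
    (A.filter fun z => z ∈ openCluster ω x) = A.filter fun z => ω ∈ openConn x z :=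
  Finset.filter_congr fun _ _ => Iff.rfl

/-- Complement of the property inside `{o ↔ A}`: for any vertex `x`,
`μ({¬P(C(x))} ∩ {o ↔ A}) = μ(o ↔ A) − μ({P(C(x))} ∩ {o ↔ A})`. [this file] -/
theorem real_notProp_inter (w : Sym2 (Fin n) → unitInterval) (A : Finset (Fin n)) (o a₁ x : Fin n) (j : ℕ) :
    (prodBernoulli w).real ({ω : BondConfig (Fin n) |
        ¬ (a₁ ∈ openCluster ω x ∨ j < (A.filter fun z => z ∈ openCluster ω x).card)} ∩ ⋃ a' ∈ A, openConn o a') =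
      (prodBernoulli w).real (⋃ a' ∈ A, (openConn o a' : Set (BondConfig (Fin n)))) -
        (prodBernoulli w).real ({ω : BondConfig (Fin n) |
          (a₁ ∈ openCluster ω x ∨ j < (A.filter fun z => z ∈ openCluster ω x).card)} ∩ ⋃ a' ∈ A, openConn o a') := by
  set μ := prodBernoulli w with hμ
  set U : Set (BondConfig (Fin n)) := ⋃ a' ∈ A, openConn o a' with hU
  set E : Set (BondConfig (Fin n)) := {ω | a₁ ∈ openCluster ω x ∨ j < (A.filter fun z => z ∈ openCluster ω x).card}
    with hE
  have hmeas : MeasurableSet E := MeasurableSet.of_discrete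
  have h := measureReal_inter_add_sdiff (μ := μ) (s := U) (t := E) (h := measure_ne_top μ _) hmeas
  have h1 : U ∩ E = E ∩ U := inter_comm _ _
  have h2 : U \ E = {ω | ¬ (a₁ ∈ openCluster ω x ∨ j < (A.filter fun z => z ∈ openCluster ω x).card)} ∩ U := by
    ext ω; simp only [mem_sdiff, mem_inter_iff, mem_setOf_eq, hE]; tauto
  rw [h1, h2] at h
  linarith

end AvoidingWitnessOneLayer

open AvoidingWitnessOneLayer

/-- **(IG₁) for one-layer observers, attached form.**  If every positive-weight edge at `o` goes to a relay
(`w s(o,u) = 0` for `u ∉ A`, `u ≠ o`), `a₁ ∈ A` and `|A| ≥ 2`, then for some `b ∈ A ∖ a₁`: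
`μ(o ↔ A, o ↮ a₁, N ≤ j) ≤ μ(o ↔ A, b ↮ a₁, M_b ≤ j)`.  Kozma–Nitzan Theorem 8 for the event property
`a₁ ∈ K ∨ j < |K ∩ A|`. [cite: KozmaNitzan2024, Thm. 8 (p. 32) with Conjecture 4 (p. 32) — corollary] -/
theorem avoidingMax_oneLayer_attached (w : Sym2 (Fin n) → unitInterval) (A : Finset (Fin n)) (o a₁ : Fin n)
    (j : ℕ) (ha₁ : a₁ ∈ A) (h2 : 2 ≤ A.card)
    (hiso : ∀ u, u ≠ o → u ∉ A → w s(o, u) = 0) :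
    ∃ b ∈ A.erase a₁,
      (prodBernoulli w).real ({ω : BondConfig (Fin n) |
          ω ∉ openConn o a₁ ∧ (A.filter fun x => ω ∈ openConn o x).card ≤ j} ∩ ⋃ a' ∈ A, openConn o a') ≤
        (prodBernoulli w).real ({ω : BondConfig (Fin n) |
          ω ∉ openConn b a₁ ∧ (A.filter fun x => ω ∈ openConn b x).card ≤ j} ∩ ⋃ a' ∈ A, openConn o a') := by
  set μ := prodBernoulli w with hμ
  have hA : A.Nonempty := ⟨a₁, ha₁⟩
  obtain ⟨a, ha, hle⟩ := KozmaNitzan2024_thm8_event w A o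
    (fun K : Set (Fin n) => a₁ ∈ K ∨ j < (A.filter fun z => z ∈ K).card) (prop_mono A a₁ j) hA hiso
  -- rewrite both sides as complements inside `{o ↔ A}`
  have key : ∀ x : Fin n,
      μ.real ({ω : BondConfig (Fin n) |
          ω ∉ openConn x a₁ ∧ (A.filter fun z => ω ∈ openConn x z).card ≤ j} ∩ ⋃ a' ∈ A, openConn o a') =
        μ.real (⋃ a' ∈ A, (openConn o a' : Set (BondConfig (Fin n)))) -
          μ.real ({ω : BondConfig (Fin n) |
            (a₁ ∈ openCluster ω x ∨ j < (A.filter fun z => z ∈ openCluster ω x).card)} ∩ ⋃ a' ∈ A, openConn o a') := by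
    intro x
    rw [← real_notProp_inter w A o a₁ x j]
    congr 1
    ext ω
    simp only [mem_inter_iff, mem_setOf_eq, not_or, not_lt, filter_openCluster]
    exact Iff.rfl
  by_cases haa : a = a₁
  · -- witness is `a₁`: the left side vanishes
    subst haa
    have hne : (A.erase a).Nonempty := by
      rw [← Finset.card_pos, Finset.card_erase_of_mem ha]; omega
    obtain ⟨b, hb⟩ := hne
    refine ⟨b, hb, ?_⟩
    have hzero : μ.real ({ω : BondConfig (Fin n) |
        ω ∉ openConn o a ∧ (A.filter fun x => ω ∈ openConn o x).card ≤ j} ∩ ⋃ a' ∈ A, openConn o a') ≤ 0 := by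
      have hself : μ.real ({ω : BondConfig (Fin n) |
          ω ∉ openConn a a ∧ (A.filter fun x => ω ∈ openConn a x).card ≤ j} ∩ ⋃ a' ∈ A, openConn o a') = 0 := by
        have : ({ω : BondConfig (Fin n) |
            ω ∉ openConn a a ∧ (A.filter fun x => ω ∈ openConn a x).card ≤ j} ∩ ⋃ a' ∈ A, openConn o a') = ∅ := by
          ext ω
          simp only [mem_inter_iff, mem_setOf_eq, mem_empty_iff_false, iff_false, not_and]
          intro h
          exact absurd (SimpleGraph.Reachable.refl a : (openGraph ω).Reachable a a) h.1
        rw [this, measureReal_empty]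
      rw [key o]; rw [key a] at hself
      linarith
    exact le_trans hzero measureReal_nonneg
  · refine ⟨a, Finset.mem_erase.2 ⟨haa, ha⟩, ?_⟩
    rw [key o, key a]
    linarith

/-- **(IG₁) for one-layer observers** in the shape of the hypothesis of `Theorems.noHeavyLowerTail_of_avoidingMax`:
for some `b ∈ A ∖ a₁`, `μ(1 ≤ N ≤ j, o ↮ a₁) ≤ μ(b ↮ a₁, M_b ≤ j)`.
[cite: KozmaNitzan2024, Thm. 8 (p. 32) — corollary] -/
theorem avoidingMax_oneLayer (w : Sym2 (Fin n) → unitInterval) (A : Finset (Fin n)) (o a₁ : Fin n)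
    (j : ℕ) (ha₁ : a₁ ∈ A) (h2 : 2 ≤ A.card)
    (hiso : ∀ u, u ≠ o → u ∉ A → w s(o, u) = 0) :
    ∃ b ∈ A.erase a₁,
      (prodBernoulli w).real {ω : BondConfig (Fin n) |
          1 ≤ (A.filter fun x => ω ∈ openConn o x).card ∧ (A.filter fun x => ω ∈ openConn o x).card ≤ j ∧
            ω ∉ openConn o a₁} ≤
        (prodBernoulli w).real {ω : BondConfig (Fin n) |
          ω ∉ openConn b a₁ ∧ (A.filter fun x => ω ∈ openConn b x).card ≤ j} := by
  set μ := prodBernoulli w with hμ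
  obtain ⟨b, hb, hle⟩ := avoidingMax_oneLayer_attached w A o a₁ j ha₁ h2 hiso
  refine ⟨b, hb, ?_⟩
  have hL : {ω : BondConfig (Fin n) |
        1 ≤ (A.filter fun x => ω ∈ openConn o x).card ∧ (A.filter fun x => ω ∈ openConn o x).card ≤ j ∧
          ω ∉ openConn o a₁} ⊆
      {ω : BondConfig (Fin n) | ω ∉ openConn o a₁ ∧ (A.filter fun x => ω ∈ openConn o x).card ≤ j} ∩
        ⋃ a' ∈ A, openConn o a' := by
    intro ω hω
    simp only [mem_setOf_eq] at hω
    obtain ⟨h1, hj, hna⟩ := hω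
    refine ⟨⟨hna, hj⟩, ?_⟩
    obtain ⟨x, hx⟩ := Finset.card_pos.1 h1
    obtain ⟨hxA, hox⟩ := Finset.mem_filter.1 hx
    exact mem_iUnion₂.2 ⟨x, hxA, hox⟩
  have hR : ({ω : BondConfig (Fin n) | ω ∉ openConn b a₁ ∧ (A.filter fun x => ω ∈ openConn b x).card ≤ j} ∩
        ⋃ a' ∈ A, openConn o a') ⊆
      {ω : BondConfig (Fin n) | ω ∉ openConn b a₁ ∧ (A.filter fun x => ω ∈ openConn b x).card ≤ j} :=
    inter_subset_left
  calc μ.real {ω : BondConfig (Fin n) |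
        1 ≤ (A.filter fun x => ω ∈ openConn o x).card ∧ (A.filter fun x => ω ∈ openConn o x).card ≤ j ∧
          ω ∉ openConn o a₁}
      ≤ μ.real ({ω : BondConfig (Fin n) | ω ∉ openConn o a₁ ∧ (A.filter fun x => ω ∈ openConn o x).card ≤ j} ∩
          ⋃ a' ∈ A, openConn o a') := measureReal_mono hL (measure_ne_top μ _)
    _ ≤ μ.real ({ω : BondConfig (Fin n) | ω ∉ openConn b a₁ ∧ (A.filter fun x => ω ∈ openConn b x).card ≤ j} ∩
          ⋃ a' ∈ A, openConn o a') := hle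
    _ ≤ _ := measureReal_mono hR (measure_ne_top μ _)


/-- Complement of the property inside an arbitrary event `U` (here `U = {o ↔ A ∖ a₁}`). [this file] -/
theorem AvoidingWitnessOneLayer.real_notProp_inter_set (w : Sym2 (Fin n) → unitInterval) (U : Set (BondConfig (Fin n)))
    (A : Finset (Fin n)) (a₁ x : Fin n) (j : ℕ) :
    (prodBernoulli w).real ({ω : BondConfig (Fin n) |
        ¬ (a₁ ∈ openCluster ω x ∨ j < (A.filter fun z => z ∈ openCluster ω x).card)} ∩ U) =
      (prodBernoulli w).real U -
        (prodBernoulli w).real ({ω : BondConfig (Fin n) |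
          (a₁ ∈ openCluster ω x ∨ j < (A.filter fun z => z ∈ openCluster ω x).card)} ∩ U) := by
  set μ := prodBernoulli w with hμ
  set E : Set (BondConfig (Fin n)) := {ω | a₁ ∈ openCluster ω x ∨ j < (A.filter fun z => z ∈ openCluster ω x).card}
    with hE
  have hmeas : MeasurableSet E := MeasurableSet.of_discrete
  have h := measureReal_inter_add_sdiff (μ := μ) (s := U) (t := E) (h := measure_ne_top μ _) hmeas
  have h1 : U ∩ E = E ∩ U := inter_comm _ _
  have h2 : U \ E = {ω | ¬ (a₁ ∈ openCluster ω x ∨ j < (A.filter fun z => z ∈ openCluster ω x).card)} ∩ U := by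
    ext ω; simp only [mem_sdiff, mem_inter_iff, mem_setOf_eq, hE]; tauto
  rw [h1, h2] at h
  linarith

/-- **(IG₁) for `|A| = 3`, attached form** — every graph, every `a₁ ∈ A`, every level `j`: for some
`b ∈ A ∖ a₁`, `μ(o ↔ A∖a₁, o ↮ a₁, N ≤ j) ≤ μ(o ↔ A∖a₁, b ↮ a₁, M_b ≤ j)`.  Kozma–Nitzan's Theorem 7
(Conjecture 4 for two relays, tree `KozmaNitzan2024_thm7_event`) applied to the relay PAIR `A ∖ a₁` and the
event property `a₁ ∈ K ∨ j < |K ∩ A|`. [cite: KozmaNitzan2024, Thm. 7 (p. 32) — corollary] -/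
theorem avoidingMax_card_three_attached (w : Sym2 (Fin n) → unitInterval) (A : Finset (Fin n)) (o a₁ : Fin n)
    (j : ℕ) (ha₁ : a₁ ∈ A) (h3 : A.card = 3) :
    ∃ b ∈ A.erase a₁,
      (prodBernoulli w).real ({ω : BondConfig (Fin n) |
          ω ∉ openConn o a₁ ∧ (A.filter fun x => ω ∈ openConn o x).card ≤ j} ∩ ⋃ a' ∈ A.erase a₁, openConn o a') ≤
        (prodBernoulli w).real ({ω : BondConfig (Fin n) |
          ω ∉ openConn b a₁ ∧ (A.filter fun x => ω ∈ openConn b x).card ≤ j} ∩ ⋃ a' ∈ A.erase a₁, openConn o a') := by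
  set μ := prodBernoulli w with hμ
  have h2 : (A.erase a₁).card = 2 := by rw [Finset.card_erase_of_mem ha₁, h3]
  obtain ⟨a, ha, hle⟩ := KozmaNitzan2024_thm7_event w (A.erase a₁) o
    (fun K : Set (Fin n) => a₁ ∈ K ∨ j < (A.filter fun z => z ∈ K).card) (prop_mono A a₁ j) h2
  refine ⟨a, ha, ?_⟩
  have key : ∀ x : Fin n,
      μ.real ({ω : BondConfig (Fin n) |
          ω ∉ openConn x a₁ ∧ (A.filter fun z => ω ∈ openConn x z).card ≤ j} ∩ ⋃ a' ∈ A.erase a₁, openConn o a') =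
        μ.real (⋃ a' ∈ A.erase a₁, (openConn o a' : Set (BondConfig (Fin n)))) -
          μ.real ({ω : BondConfig (Fin n) |
            (a₁ ∈ openCluster ω x ∨ j < (A.filter fun z => z ∈ openCluster ω x).card)} ∩
              ⋃ a' ∈ A.erase a₁, openConn o a') := by
    intro x
    rw [← AvoidingWitnessOneLayer.real_notProp_inter_set w (⋃ a' ∈ A.erase a₁, (openConn o a' : Set (BondConfig (Fin n)))) A a₁ x j]
    congr 1
    ext ω
    simp only [mem_inter_iff, mem_setOf_eq, not_or, not_lt, filter_openCluster]
    exact Iff.rfl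
  rw [key o, key a]
  linarith

/-- **(IG₁) for `|A| = 3`** in the shape of the hypothesis of `Theorems.noHeavyLowerTail_of_avoidingMax`: for some
`b ∈ A ∖ a₁`, `μ(1 ≤ N ≤ j, o ↮ a₁) ≤ μ(b ↮ a₁, M_b ≤ j)`.  With `avoidingMax_levelOne` (j = 1, all `|A|`) and the
one-layer class above, (IG₁) is thus a theorem on both classes where Kozma–Nitzan's Conjecture 4 is known.
[cite: KozmaNitzan2024, Thm. 7 (p. 32) — corollary] -/
theorem avoidingMax_card_three (w : Sym2 (Fin n) → unitInterval) (A : Finset (Fin n)) (o a₁ : Fin n)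
    (j : ℕ) (ha₁ : a₁ ∈ A) (h3 : A.card = 3) :
    ∃ b ∈ A.erase a₁,
      (prodBernoulli w).real {ω : BondConfig (Fin n) |
          1 ≤ (A.filter fun x => ω ∈ openConn o x).card ∧ (A.filter fun x => ω ∈ openConn o x).card ≤ j ∧
            ω ∉ openConn o a₁} ≤
        (prodBernoulli w).real {ω : BondConfig (Fin n) |
          ω ∉ openConn b a₁ ∧ (A.filter fun x => ω ∈ openConn b x).card ≤ j} := by
  set μ := prodBernoulli w with hμ
  obtain ⟨b, hb, hle⟩ := avoidingMax_card_three_attached w A o a₁ j ha₁ h3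
  refine ⟨b, hb, ?_⟩
  have hL : {ω : BondConfig (Fin n) |
        1 ≤ (A.filter fun x => ω ∈ openConn o x).card ∧ (A.filter fun x => ω ∈ openConn o x).card ≤ j ∧
          ω ∉ openConn o a₁} ⊆
      {ω : BondConfig (Fin n) | ω ∉ openConn o a₁ ∧ (A.filter fun x => ω ∈ openConn o x).card ≤ j} ∩
        ⋃ a' ∈ A.erase a₁, openConn o a' := by
    intro ω hω
    simp only [mem_setOf_eq] at hω
    obtain ⟨h1, hj, hna⟩ := hω
    refine ⟨⟨hna, hj⟩, ?_⟩
    obtain ⟨x, hx⟩ := Finset.card_pos.1 h1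
    obtain ⟨hxA, hox⟩ := Finset.mem_filter.1 hx
    have hxa : x ≠ a₁ := by rintro rfl; exact hna hox
    exact mem_iUnion₂.2 ⟨x, Finset.mem_erase.2 ⟨hxa, hxA⟩, hox⟩
  calc μ.real {ω : BondConfig (Fin n) |
        1 ≤ (A.filter fun x => ω ∈ openConn o x).card ∧ (A.filter fun x => ω ∈ openConn o x).card ≤ j ∧
          ω ∉ openConn o a₁}
      ≤ μ.real ({ω : BondConfig (Fin n) | ω ∉ openConn o a₁ ∧ (A.filter fun x => ω ∈ openConn o x).card ≤ j} ∩
          ⋃ a' ∈ A.erase a₁, openConn o a') := measureReal_mono hL (measure_ne_top μ _)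
    _ ≤ μ.real ({ω : BondConfig (Fin n) | ω ∉ openConn b a₁ ∧ (A.filter fun x => ω ∈ openConn b x).card ≤ j} ∩
          ⋃ a' ∈ A.erase a₁, openConn o a') := hle
    _ ≤ _ := measureReal_mono inter_subset_left (measure_ne_top μ _)

end Summit.CriticalPhenomena.PercolationContinuityZ3.Theorems

end
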